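import Summits.HubbardSuperconductivity.HubbardSuperconductivity.Theorems.AnisotropyChordTransferFibre3FinX5Eval
import Summits.HubbardSuperconductivity.HubbardSuperconductivity.Theorems.AnisotropyChordTransferFibre3ZSquareKernel
import Summits.HubbardSuperconductivity.HubbardSuperconductivity.Theorems.AnisotropyChordTransferFibre3KernelHarmonicity

/-!
# Route `AnisotropyChord` / H0 rotor rung: FIN per-`L` GM₃ (X5) — the Green point wedge encloses `G̃_λ`, with `D₄` folding

Soundness layer 1 of `…FinX5Eval`: ★ `mem_gWedgePt` — the row–column point wedge `gWedgePt L lam` encloses `G̃_{λ₀}(r₁,r₂)` for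
`0 ≤ r₂ ≤ r₁ ≤ L/2` at every real `λ₀` with `λ₀·D ∈ [lam, lam]` (g4's `mem_rcEntry` / `mem_aTabT` / `rc_identity` on the half inner
tables); ★ `mem_gW` — the folded lookup `gW` encloses `G̃_{λ₀}(r₁,r₂)` for ALL `r₁, r₂ < L` (`Gres_mirror`, `Gres_neg`, `Gres_swap`).
Prover seat `hubbard-h0-rotor-p3` g8; helper for piece A = stmt-HubbardSuperconductivity-23918 of rung 19089 (`--supports`, helper
class).  WHAT THIS IS NOT: nothing here proves superconductivity in the Hubbard model (rotor TARGET as worded stays FALSE, g15 verdict);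
evaluator soundness for the FIN certificates of ONE conditional reduction.  Tree imports only; no sorry, no new axioms.
-/

set_option linter.dupNamespace false
set_option autoImplicit false

namespace Summit.HubbardSuperconductivity.HubbardSuperconductivity.Theorems.AnisotropyChord.Transfer.Fibre3

namespace FinCell

open scoped BigOperators
open Hole2 FinXB
open Finset hiding fold

variable {L : ℕ} [NeZero L]

omit [NeZero L] in
/-- rows of the half inner table are rows of g4's full inner table. [folklore] -/
theorem getD_aTabH (trows etz : List (List Iv)) {r2 : ℕ} (hr2 : r2 < L / 2 + 1) (hr2L : r2 < L) :
    (aTabH L trows etz).getD r2 [] = (aTabT L trows etz).getD r2 [] := by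
  unfold aTabH aTabT
  rw [getD_map_range _ _ hr2, mkTab_row _ hr2L]

omit [NeZero L] in
/-- entries of the point wedge. [folklore] -/
theorem getT_gWedgePt (lam : ℤ) {r1 r2 : ℕ} (hr1 : r1 ≤ L / 2) (hr2 : r2 ≤ r1) (hL : 2 ≤ L) :
    getT (gWedgePt L lam) r1 r2 =
      rcEntry L ((trigRows L (cosTab L)).getD r1 []) ((trigRows L (sinTab L)).getD r1 [])
        ((aTabT L (trigRows L (cosTab L)) (etZ (gresCellTab L (cosTab L) lam lam))).getD r2 [])
        ((aTabT L (trigRows L (sinTab L)) (etZ (gresCellTab L (cosTab L) lam lam))).getD r2 []) := by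
  have hr2' : r2 < L / 2 + 1 := by omega
  have hr2L : r2 < L := by omega
  unfold gWedgePt getT
  simp only
  rw [getD_map_range _ _ (by omega), getD_map_range _ _ (by omega), getD_aTabH _ _ hr2' hr2L, getD_aTabH _ _ hr2' hr2L]

/-- ★ THE POINT WEDGE ENCLOSES `G̃`: for `λ₀·D ∈ [lam, lam]` and `0 ≤ r₂ ≤ r₁ ≤ L/2`. [folklore] -/
theorem mem_gWedgePt (hL : 3 ≤ L) {lam0 : ℝ} {lam : ℤ}
    (hla : (lam : ℝ) ≤ lam0 * ((D : ℤ) : ℝ)) (hlb : lam0 * ((D : ℤ) : ℝ) ≤ (lam : ℝ))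
    (hpos : denCellPos L (cosTab L) lam lam = true) {r1 r2 : ℕ} (hr1 : r1 ≤ L / 2) (hr2 : r2 ≤ r1) :
    mem (Gres L lam0 (((r1 : ℕ) : ZMod L), ((r2 : ℕ) : ZMod L))) (getT (gWedgePt L lam) r1 r2) := by
  have hL0 : 0 < L := by omega
  have hr1L : r1 < L := by omega
  have hr2L : r2 < L := by omega
  rw [Gres_eq_sum L lam0 hr1L hr2L, rc_identity hL0, getT_gWedgePt lam hr1 hr2 (by omega)]
  have hent := mem_gresCellTab L hL hla hlb hpos
  refine mem_rcEntry hL _ _ _ _ _ _ _ _ ?_ ?_ ?_ ?_ (fun j hj => ?_) (fun j hj => ?_) (fun j hj => ?_) (fun j hj => ?_)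
  · unfold trigRows; exact length_mkTab_row _ hr1L
  · unfold trigRows; exact length_mkTab_row _ hr1L
  · unfold aTabT; exact length_mkTab_row _ hr2L
  · unfold aTabT; exact length_mkTab_row _ hr2L
  · unfold trigRows; rw [getIv_mkTab_row _ hr1L hj]; exact mem_cos_kr hL j r1
  · unfold trigRows; rw [getIv_mkTab_row _ hr1L hj]; exact mem_sin_kr hL j r1
  · exact mem_aTabT hL (fun n : ℕ => Real.cos (2 * Real.pi * (n : ℝ) / L)) (cosTab L) (fun k r => mem_cos_kr hL k r)
      (gw L lam0) _ hent hr2L hj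
  · exact mem_aTabT hL (fun n : ℕ => Real.sin (2 * Real.pi * (n : ℝ) / L)) (sinTab L) (fun k r => mem_sin_kr hL k r)
      (gw L lam0) _ hent hr2L hj

/-! ## Folding -/

/-- `G̃(fold r₁, r₂) = G̃(r₁, r₂)` (mirror in the first coordinate). [folklore] -/
theorem Gres_fold₁ (lam0 : ℝ) {r1 : ℕ} (hr1 : r1 < L) (y : ZMod L) :
    Gres L lam0 ((((fold L r1 : ℕ)) : ZMod L), y) = Gres L lam0 ((((r1 : ℕ)) : ZMod L), y) := by
  unfold fold
  split_ifs with h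
  · rfl
  · have e : (((L - r1 : ℕ) : ZMod L)) = -(((r1 : ℕ) : ZMod L)) := by
      rw [Nat.cast_sub hr1.le, ZMod.natCast_self, zero_sub]
    rw [e]
    exact Subsample.Gres_mirror L lam0 ((((r1 : ℕ)) : ZMod L), y)

/-- `G̃(x, fold r₂) = G̃(x, r₂)` (mirror in the second coordinate, from the first by two swaps). [folklore] -/
theorem Gres_fold₂ (lam0 : ℝ) (x : ZMod L) {r2 : ℕ} (hr2 : r2 < L) :
    Gres L lam0 (x, (((fold L r2 : ℕ)) : ZMod L)) = Gres L lam0 (x, (((r2 : ℕ)) : ZMod L)) := by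
  have h1 := Gres_swap L lam0 (((((fold L r2 : ℕ)) : ZMod L)), x)
  have h2 := Gres_swap L lam0 (((((r2 : ℕ)) : ZMod L)), x)
  simp only at h1 h2
  rw [h1, h2, Gres_fold₁ lam0 hr2 x]

/-- ★ THE FOLDED LOOKUP ENCLOSES `G̃(r₁,r₂)` for all `r₁, r₂ < L`. [folklore] -/
theorem mem_gW (hL : 3 ≤ L) {lam0 : ℝ} {lam : ℤ}
    (hla : (lam : ℝ) ≤ lam0 * ((D : ℤ) : ℝ)) (hlb : lam0 * ((D : ℤ) : ℝ) ≤ (lam : ℝ))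
    (hpos : denCellPos L (cosTab L) lam lam = true) {r1 r2 : ℕ} (hr1 : r1 < L) (hr2 : r2 < L) :
    mem (Gres L lam0 (((r1 : ℕ) : ZMod L), ((r2 : ℕ) : ZMod L))) (gW L (gWedgePt L lam) r1 r2) := by
  have ha := fold_le hr1
  have hb := fold_le hr2
  rw [← Gres_fold₁ lam0 hr1, ← Gres_fold₂ lam0 _ hr2]
  unfold gW
  simp only
  split_ifs with h
  · exact mem_gWedgePt hL hla hlb hpos ha h
  · have h' : fold L r1 ≤ fold L r2 := by omega
    have hs := Gres_swap L lam0 (((((fold L r2 : ℕ)) : ZMod L)), ((((fold L r1 : ℕ)) : ZMod L)))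
    simp only at hs
    rw [hs]
    exact mem_gWedgePt hL hla hlb hpos hb h'

end FinCell

end Summit.HubbardSuperconductivity.HubbardSuperconductivity.Theorems.AnisotropyChord.Transfer.Fibre3
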